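import Summits.BirchSwinnertonDyer.BirchSwinnertonDyer.Theses.TwistFamilyManinDescent
import Summits.BirchSwinnertonDyer.Rank1Residual.LW16.IsogenyKummerDegenerationReducible
import Summits.BirchSwinnertonDyer.Rank1Residual.Additive.TypeGIntegralJ
import Literature.NumberTheory.EllipticCurves.ComplexMultiplicationHasCMThirteenProofs
import Literature.NumberTheory.EllipticCurves.DeuringSupersingularReductionHoldsProofs
import HarnessLib

/-!
# Route `TwistFamilyManinDescent`, LINE 12 support item `CMCornerNotOrdinaryAtOneSixtyThree`
# (stmt-BirchSwinnertonDyer-25942): the `163`-corner of the Eisenstein residual is potentially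
# SUPERSINGULAR

Cell `pub/bsd-wall`, seat `bsd-line-ttd-p1` (g6). Known mathematics, kernel-checked from tree
theorems and ONE printed hypothesis carried by the item itself (Mazur 1978 / Kenku 1982: the
`j`-table of rational isogenies of prime degree `ℓ ∈ {11, 17, 19, 37, 43, 67, 163}`, the tree's
cite-only fact `primeDegreeIsogeny_jTable`): a curve `W/ℚ` with `W[163]` REDUCIBLE carries a
rational `163`-isogeny (`LW16.IsogenyEdge.exists_isogeny_comp_eq_prime_smul_of_not_irreducible`),
so `j(W) = −640320³` (the table), so `W` has CM by the maximal order of `ℚ(√−163)`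
(`hasCM_of_j_eq_neg262537412640768000`), `163` ramifies there (`¬ CMSplit W 163`:
`cmFieldDiscrOfJ j = −163`), and by Deuring's criterion (tree theorem
`deuring_not_hasUnitRootAt_of_hasCM_of_not_cmSplit_holds`) no base change of `W` to a number field
has good ORDINARY (unit-root) reduction at a place above `163`: `¬ TypeGOrd W 163`. Closes the item
BY NAME (`cmCornerNotOrdinaryAtOneSixtyThree_proof`); the refuter's attached candidate (evidence
`Cand25942.lean`, refuter-bsd-print-cf2-ref g6) follows the same chain. BSD is not proved by this;
Manin's conjecture is not proved by this.
-/

set_option autoImplicit false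
-- single-conjunct summit: `Summit.BirchSwinnertonDyer.BirchSwinnertonDyer.…` repeats the name by design
set_option linter.dupNamespace false

noncomputable section

open scoped Classical NumberField

open WeierstrassCurve IsDedekindDomain NumberField Literature.NumberTheory.EllipticCurves
  Literature.NumberTheory.EllipticCurves.Rank1Residual Summit.BirchSwinnertonDyer.Rank1Residual.Additive

namespace Summit.BirchSwinnertonDyer.BirchSwinnertonDyer.Theorems.TwistFamilyManinDescent

/-- From the `j`-table of rational `163`-isogenies: a curve with `W[163]` reducible has
`j = −640320³ = −262537412640768000`. [cite: Mazur1978, Thm. 1 and table p. 129]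
[cite: CremonaAlgorithms1997, §3.8 p. 82] -/
theorem j_eq_of_not_hasIrreducibleModPGaloisRep_oneSixtyThree (hT : primeDegreeIsogeny_jTable)
    (W : WeierstrassCurve ℚ) [W.IsElliptic] (hred : ¬ W.HasIrreducibleModPGaloisRep 163) :
    W.j = -262537412640768000 := by
  haveI : Fact (Nat.Prime 163) := ⟨by norm_num⟩
  obtain ⟨W', hW', φ, -, hdeg, -, -⟩ :=
    Summit.BirchSwinnertonDyer.Rank1Residual.LW16.IsogenyEdge.exists_isogeny_comp_eq_prime_smul_of_not_irreducible
      W hred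
  haveI := hW'
  have hmem := hT W W' φ (by rw [hdeg]; decide)
  rw [hdeg, largePrimeIsogenyJTable] at hmem
  simp only [Finset.mem_insert, Finset.mem_singleton, Prod.mk.injEq] at hmem
  norm_num at hmem
  exact hmem

/-- **Item `CMCornerNotOrdinaryAtOneSixtyThree` (stmt-BirchSwinnertonDyer-25942) BY NAME.** Granted
the prime-degree isogeny `j`-table (`primeDegreeIsogeny_jTable`, the item's own hypothesis), an
elliptic `W/ℚ` with `W[163]` reducible is NOT (G)-ordinary at `163`: `j(W) = −640320³`, CM by
`ℤ[(1+√−163)/2]`, `163` ramified in `ℚ(√−163)`, Deuring ⟹ every good fibre above `163` over every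
number field is supersingular (`deuring_not_hasUnitRootAt_of_hasCM_of_not_cmSplit_holds`).
[cite: Mazur1978, Thm. 1] [cite: SilvermanATAEC1994, App. A §3] [cite: Lang1987, Ch. 13 §4 Thm. 12] -/
theorem cmCornerNotOrdinaryAtOneSixtyThree_proof :
    Summit.BirchSwinnertonDyer.BirchSwinnertonDyer.Theses.TwistFamilyManinDescent.CMCornerNotOrdinaryAtOneSixtyThree := by
  intro hT W _ hred hG
  haveI : Fact (Nat.Prime 163) := ⟨by norm_num⟩
  have hj : W.j = -262537412640768000 :=
    j_eq_of_not_hasIrreducibleModPGaloisRep_oneSixtyThree hT W hred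
  have hCM : W.HasCM := hasCM_of_j_eq_neg262537412640768000 W hj
  have hns : ¬ CMSplit W 163 := by
    intro h
    have h1 := h.1
    rw [hj] at h1
    exact h1 (by norm_num [cmFieldDiscrOfJ])
  obtain ⟨L, _, _, _, F, hF⟩ := hG
  haveI : NumberField F := NumberField.of_module_finite ℚ F
  obtain ⟨w, hw⟩ := exists_heightOneSpectrum_natCast_mem F 163
  exact deuring_not_hasUnitRootAt_of_hasCM_of_not_cmSplit_holds W hCM 163 (by norm_num) hns F w hw
    (hF w hw).1 (hF w hw).2

end Summit.BirchSwinnertonDyer.BirchSwinnertonDyer.Theorems.TwistFamilyManinDescent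

end
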